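import Mathlib

/-!
# Tier 4 · Line 4 — W6 «isolation» (abstract glue for the wall `mixed_two_torus`, plan-4 S12873 DECOMPOSITION A)

The two-torus relative trace formula (plan-4's V5, W4 + W5) would write a two-character double period as a finite
spectral sum `∑_V λ_V(f) · P_T(v′_V)`; the ONLY rung of that decomposition provable today is the abstract glue:
a non-zero finite (or summable) sum has a non-zero term, whose two factors are then both non-zero.  Nothing here
touches the wall's hypotheses W4 / W5 (the spectral expansion and the geometric main term are unprinted automorphic
inputs, lit-1 S12876): this module is the `Finset.exists_ne_zero_of_sum_ne_zero` step in the tree's name space, nothing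
more.  HC_CM is NOT proved by anyone in this repository.
-/

namespace Summit.Ventures.HodgeRepro.Tier4.Line4.Isolation

/-- W6 (finite form): a non-zero finite spectral sum `∑_{V ∈ s} λ_V · P_V` has a term `V ∈ s` with BOTH factors
non-zero — the step turning «the RTF double period is non-zero» into «some `V` has `λ_V(f) ≠ 0` and the mixed period
`P_T(v′_V) ≠ 0`». -/
theorem exists_ne_zero_of_sum_mul_ne_zero {ι : Type*} (s : Finset ι) (lam P : ι → ℂ)
    (h : ∑ V ∈ s, lam V * P V ≠ 0) : ∃ V ∈ s, lam V ≠ 0 ∧ P V ≠ 0 := by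
  obtain ⟨V, hV, hne⟩ := Finset.exists_ne_zero_of_sum_ne_zero h
  exact ⟨V, hV, left_ne_zero_of_mul hne, right_ne_zero_of_mul hne⟩

/-- W6 (summable form): the same for a convergent spectral sum `HasSum (fun V => λ_V · P_V) S` with `S ≠ 0`
(the cuspidal spectrum at a level is finite, but the statement does not need that). -/
theorem exists_ne_zero_of_hasSum_mul_ne_zero {ι : Type*} (lam P : ι → ℂ) (S : ℂ)
    (hS : HasSum (fun V => lam V * P V) S) (h : S ≠ 0) : ∃ V, lam V ≠ 0 ∧ P V ≠ 0 := by
  by_contra hcon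
  push Not at hcon
  have hzero : (fun V => lam V * P V) = fun _ => (0 : ℂ) := by
    funext V
    by_cases hl : lam V = 0
    · simp [hl]
    · simp [hcon V hl]
  rw [hzero] at hS
  exact h (hS.unique hasSum_zero)

/-- W6 (two-factor form with a weight): if `∑_{V ∈ s} λ_V · P_V · Q_V ≠ 0` then some `V ∈ s` has all three factors
non-zero — the shape of the seesaw sum `∑_V L_V · P_T(v′_V)` once the Rallis factor `L_V` is split off. -/
theorem exists_ne_zero_of_sum_mul_mul_ne_zero {ι : Type*} (s : Finset ι) (lam P Q : ι → ℂ)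
    (h : ∑ V ∈ s, lam V * P V * Q V ≠ 0) : ∃ V ∈ s, lam V ≠ 0 ∧ P V ≠ 0 ∧ Q V ≠ 0 := by
  obtain ⟨V, hV, hne⟩ := Finset.exists_ne_zero_of_sum_ne_zero h
  exact ⟨V, hV, left_ne_zero_of_mul (left_ne_zero_of_mul hne), right_ne_zero_of_mul (left_ne_zero_of_mul hne),
    right_ne_zero_of_mul hne⟩

end Summit.Ventures.HodgeRepro.Tier4.Line4.Isolation
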